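import Summits.MatrixMultiplication.OmegaCensus.SmallFormats.MatMul22nRankGF7Slack4SearchSound
import Summits.MatrixMultiplication.OmegaCensus.SmallFormats.MatMul22nRankGF7Slack4SearchEqns
import HarnessLib

/-!
# ω-census family (a): soundness of the slack-4 search checker — keys, buckets, the search (part 2)

Cell `pub-omega` (unit `pub-omega-tensor-g15`), topic `Summits/MatrixMultiplication/OmegaCensus` (sub-folder `SmallFormats`).
Framing (verbatim): lottery ticket; floor = certified bounds/negative ranges. HONEST FRAMING: kernel infrastructure (soundness of
`MatMul22nRankGF7Slack4Search`, `pub-omega-tensor-g15/KERNEL-S4-DESIGN.md` §7 (iii)–(vi)); nothing here is progress on `ω`.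

(`relKey_eq_relNeed7`, `colKey_eq_needKey7`) at levels `1..5` the key of the true packed column equals the need computed from the
earlier true columns; (`child_of_slotOK7`) if CHECK A holds for all slots then the true column is among the bucket children;
(`detBad7_false`, `detDies7_sound`) at a tight point the determination phase can never report a death, so `detDies7 … = true` is absurd;
(`srch7_sound`, `search7_sound`) `search7 c = true` refutes every LP-tight point whose torus-`0` column is `repVal7 c`.
-/

namespace Summit.MatrixMultiplication.OmegaCensus.SmallFormats

open Finset
open Literature.NumberTheory.NumberFields (list_sum_range_map)

/-! ## Keys -/

/-- **Key = need** for a cross relation of level `j ∈ [1,5]` at a tight point (true columns). -/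
theorem relKey_eq_relNeed7 (x : ℕ → ℕ) (hrows : ∀ r < 1274, capRowVal7 x r ≤ rhs7s 4 r)
    (hge : (208 : ℤ) ≤ ∑ j ∈ range 401, (x j : ℤ)) {j : ℕ} (hj1 : 1 ≤ j) (hj5 : j ≤ 5)
    {r : ℕ} (hr1 : crossOff7 j ≤ r) (hr2 : r < crossOff7 (j + 1)) :
    relKey7 (crossRel7 r) j (colPack7 x j) = relNeed7 (crossRel7 r) j ((List.range j).map (colPack7 x)) := by
  obtain ⟨_, hT, hR, _, _⟩ := tight7_of_total_ge 4 x hrows (by push_cast; linarith)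
  obtain ⟨_, h35f⟩ := crossOff7_ok ⟨j, by omega⟩ hj1
  have h35 : crossOff7 (j + 1) ≤ 35 := h35f
  have hr35 : r < 35 := by omega
  obtain ⟨hi0, huj0⟩ := crossRel7_lev ⟨j, by omega⟩ ⟨r, hr35⟩ hr1 hr2
  have hfree0 := crossRel7_free ⟨j, by omega⟩ ⟨r, hr35⟩ hr1 hr2
  have hi : crossRel7 r < 809 := hi0
  have huj : relU7 (crossRel7 r) / 42 = j := huj0
  have hfree : ∀ t < 73, (7 - relD7 (crossRel7 r) t) % 7 ≠ 0 → freeIdx7 t / 42 ≤ j := fun t ht hne => by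
    rcases hfree0 ⟨t, ht⟩ with h0 | hle
    · exact absurd h0 hne
    · exact hle
  set i := crossRel7 r with hidef
  have hmod := rel_mod7 x (fun r hr => by exact_mod_cast hT r hr) (fun k hk => by exact_mod_cast hR k hk) hi
  -- torus-j part
  have hkey : relKey7 i j (colPack7 x j) = (∑ z ∈ range 42, Pc7 x (42 * j + z) * relCoef7 (relU7 i) (relD7 i) (42 * j + z)) % 7 := by
    unfold relKey7
    rw [dot_relE7 x hrows hge hi (by omega)]
    have e : ∀ z ∈ range 42, colN7 x j z * relCoef7 (relU7 i) (relD7 i) (42 * j + z)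
        = Pc7 x (42 * j + z) * relCoef7 (relU7 i) (relD7 i) (42 * j + z) := by
      intro z hz
      have hz' := mem_range.1 hz
      unfold Pc7; rw [show (42 * j + z) / 42 = j by omega, show (42 * j + z) % 42 = z by omega]
    rw [sum_congr rfl e]
  -- the functional over tori ≤ j equals the full functional
  have hsplit : ∑ u ∈ range (42 * (j + 1)), Pc7 x u * relCoef7 (relU7 i) (relD7 i) u
      = ∑ u ∈ range (42 * j), Pc7 x u * relCoef7 (relU7 i) (relD7 i) u
        + ∑ z ∈ range 42, Pc7 x (42 * j + z) * relCoef7 (relU7 i) (relD7 i) (42 * j + z) := by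
    rw [show 42 * (j + 1) = 42 * j + 42 by ring, sum_range_add]
  have hfull : ∑ u ∈ range (42 * (j + 1)), Pc7 x u * relCoef7 (relU7 i) (relD7 i) u
      = Pc7 x (relU7 i) + ∑ t ∈ range 73, (7 - relD7 i t) % 7 * Pc7 x (freeIdx7 t) := by
    rw [relCoef_sum7 x i (j + 1), if_pos (by omega)]
    have e : ∀ t ∈ range 73, (if freeIdx7 t < 42 * (j + 1) then (7 - relD7 i t) % 7 * Pc7 x (freeIdx7 t) else 0)
        = (7 - relD7 i t) % 7 * Pc7 x (freeIdx7 t) := by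
      intro t ht
      by_cases h0 : (7 - relD7 i t) % 7 = 0
      · rw [h0, zero_mul]; split_ifs <;> rfl
      · rw [if_pos]; have := hfree t (mem_range.1 ht) h0; omega
    rw [sum_congr rfl e]
  have hpart := relPart7_eq x hrows hge hi (k := j) (by omega)
  unfold relNeed7
  rw [hpart, hkey]
  have hAB : (if relU7 i < 42 * j then Pc7 x (relU7 i) else 0)
      + ∑ t ∈ range 73, (if freeIdx7 t < 42 * j then (7 - relD7 i t) % 7 * Pc7 x (freeIdx7 t) else 0)
      + ∑ z ∈ range 42, Pc7 x (42 * j + z) * relCoef7 (relU7 i) (relD7 i) (42 * j + z)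
      = Pc7 x (relU7 i) + ∑ t ∈ range 73, (7 - relD7 i t) % 7 * Pc7 x (freeIdx7 t) := by
    rw [← hfull, hsplit, relCoef_sum7 x i j]
  have hC7 : relC7 i < 7 := by rw [← hmod]; exact Nat.mod_lt _ (by norm_num)
  rw [← hAB] at hmod
  omega

/-- The keys agree at level `j`. -/
theorem colKey_eq_needKey7 (x : ℕ → ℕ) (hrows : ∀ r < 1274, capRowVal7 x r ≤ rhs7s 4 r)
    (hge : (208 : ℤ) ≤ ∑ j ∈ range 401, (x j : ℤ)) {j : ℕ} (hj1 : 1 ≤ j) (hj5 : j ≤ 5) :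
    colKey7 j (colPack7 x j) = needKey7 j ((List.range j).map (colPack7 x)) := by
  unfold colKey7 needKey7
  rw [List.map_congr_left (fun rr hrr => by
    rw [relKey_eq_relNeed7 x hrows hge hj1 hj5 (r := crossOff7 j + rr) (by omega)
      (by have := List.mem_range.1 hrr; omega)])]

/-! ## CHECK A ⇒ the true column is a child -/

/-- Packed slot patterns are `pack10` packings. -/
theorem slotPack7_eq (c h : ℕ) : slotPack7 c h = pack10 (fun z => repVal7 c (omAct7 h z)) 42 := by
  unfold slotPack7 pack10; rw [list_sum_range_map]

/-- The true column of torus `j < 21` is a slot pattern, as a packing. -/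
theorem colPack7_slot (x : ℕ → ℕ) (hrows : ∀ r < 1274, capRowVal7 x r ≤ rhs7s 4 r)
    (hge : (208 : ℤ) ≤ ∑ j ∈ range 401, (x j : ℤ)) {j : ℕ} (hj : j < 21) :
    ∃ c' < 120, ∃ h < 336, slotPack7 c' h = colPack7 x j := by
  obtain ⟨c', hc', h, hh, hval⟩ := slot_of_pat7 (slack4_tight_cols7 x hrows hge hj)
  refine ⟨c', hc', h, hh, ?_⟩
  rw [slotPack7_eq]; unfold colPack7 pack10
  exact sum_congr rfl fun z hz => by rw [hval z (mem_range.1 hz)]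

/-- **If CHECK A holds for every slot, the true column is among the children of the true need key** (levels `1..5`). -/
theorem child_of_slotOK7 (hA : ∀ c' < 120, ∀ h < 336, slotOK7 c' h = true) (x : ℕ → ℕ)
    (hrows : ∀ r < 1274, capRowVal7 x r ≤ rhs7s 4 r) (hge : (208 : ℤ) ≤ ∑ j ∈ range 401, (x j : ℤ))
    {j : ℕ} (hj1 : 1 ≤ j) (hj5 : j ≤ 5)
    (hvis : visited7 j (needKey7 j ((List.range j).map (colPack7 x))) = true) :
    ∃ e ∈ bucket7 j (needKey7 j ((List.range j).map (colPack7 x))), slotPack7 e.1 e.2 = colPack7 x j := by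
  obtain ⟨c', hc', h, hh, hslot⟩ := colPack7_slot x hrows hge (j := j) (by omega)
  have hok := hA c' hc' h hh
  unfold slotOK7 at hok
  rw [List.all_eq_true] at hok
  have hj' := hok (j - 1) (List.mem_range.2 (by omega))
  simp only [show j - 1 + 1 = j by omega] at hj'
  rw [hslot, colKey_eq_needKey7 x hrows hge hj1 hj5, hvis] at hj'
  simp only [Bool.not_true, Bool.false_or, List.any_eq_true, beq_iff_eq] at hj'
  obtain ⟨e, he, heq⟩ := hj'
  exact ⟨e, he, heq⟩

/-! ## The determination phase dies only by contradiction -/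

/-- The true column passes the heptad test. -/
theorem heptBad7_col (x : ℕ → ℕ) (hrows : ∀ r < 1274, capRowVal7 x r ≤ rhs7s 4 r)
    (hge : (208 : ℤ) ≤ ∑ j ∈ range 401, (x j : ℤ)) {jj : ℕ} (hjj21 : jj < 21) :
    heptBad7 ((List.range 42).map (colN7 x jj)) = false := by
  obtain ⟨_, hh⟩ := slack4_tight_cols7 x hrows hge hjj21
  unfold heptBad7
  rw [Bool.not_eq_false', List.all_eq_true]
  intro hb hhb
  have hhb' := List.mem_range.1 hhb
  rw [beq_iff_eq, list_sum_range_map]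
  have hget : ∀ i ∈ range 7, ((List.range 42).map (colN7 x jj)).getD (heptPt7 (hb / 6) (hb % 6) i) 0 = colN7 x jj (heptPt7 (hb / 6) (hb % 6) i) := by
    intro i hi
    exact getD_map_range7 (colN7 x jj) (heptPt7_lt ⟨hb / 6, by omega⟩ ⟨hb % 6, Nat.mod_lt _ (by norm_num)⟩ ⟨i, mem_range.1 hi⟩)
  rw [sum_congr rfl hget]
  have := hh (hb / 6) (by omega) (hb % 6) (Nat.mod_lt _ (by norm_num))
  omega

/-- At a tight point no torus `jj ∈ [6, 21)` reports a death. -/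
theorem detBad7_false (x : ℕ → ℕ) (hrows : ∀ r < 1274, capRowVal7 x r ≤ rhs7s 4 r)
    (hge : (208 : ℤ) ≤ ∑ j ∈ range 401, (x j : ℤ)) {jj : ℕ} (hjj : 6 ≤ jj) (hjj21 : jj < 21) :
    detBad7 jj ((List.range 6).map (colPack7 x)) = false := by
  have e : ((List.range 42).map fun z => relNeed7 (relStart7 jj + z) 6 ((List.range 6).map (colPack7 x))) = (List.range 42).map (colN7 x jj) :=
    List.map_congr_left fun z hz => detCoord7_eq x hrows hge hjj hjj21 (List.mem_range.1 hz)
  have hall : ((List.range 42).map (colN7 x jj)).all (· ≤ 4) = true := by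
    rw [List.all_eq_true]
    intro v hv
    rw [List.mem_map] at hv
    obtain ⟨z, hz, rfl⟩ := hv
    exact decide_eq_true (colN7_le4 x hrows hge hjj21 z (List.mem_range.1 hz))
  unfold detBad7
  simp only [e]
  rw [hall, heptBad7_col x hrows hge hjj21]
  rfl

/-- **The determination phase cannot kill a genuine tight point.** -/
theorem detDies7_sound (x : ℕ → ℕ) (hrows : ∀ r < 1274, capRowVal7 x r ≤ rhs7s 4 r)
    (hge : (208 : ℤ) ≤ ∑ j ∈ range 401, (x j : ℤ)) :
    ∀ fuel jj, 6 ≤ jj → detDies7 ((List.range 6).map (colPack7 x)) fuel jj = true → False := by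
  intro fuel
  induction fuel with
  | zero => intro jj _ h; rw [detDies7_zero] at h; exact Bool.false_ne_true h
  | succ fuel ih =>
    intro jj hjj h
    rw [detDies7_succ] at h
    by_cases h21 : 21 ≤ jj
    · rw [if_pos h21] at h; exact Bool.false_ne_true h
    · rw [if_neg h21, detBad7_false x hrows hge hjj (by omega), Bool.false_or] at h
      exact ih (jj + 1) (by omega) h

/-! ## The search -/

/-- **Soundness of the search** from level `j` with the true packed columns of tori `< j`. -/
theorem srch7_sound (hA : ∀ c' < 120, ∀ h < 336, slotOK7 c' h = true) (x : ℕ → ℕ)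
    (hrows : ∀ r < 1274, capRowVal7 x r ≤ rhs7s 4 r) (hge : (208 : ℤ) ≤ ∑ j ∈ range 401, (x j : ℤ)) :
    ∀ fuel j, 1 ≤ j → j ≤ 6 → srch7 fuel j ((List.range j).map (colPack7 x)) = true → False := by
  intro fuel
  induction fuel with
  | zero => intro j _ _ h; rw [srch7_zero] at h; exact Bool.false_ne_true h
  | succ fuel ih =>
    intro j hj1 hj6 h
    rw [srch7_succ] at h
    by_cases h6 : 6 ≤ j
    · rw [if_pos h6] at h
      have : j = 6 := by omega
      subst this
      exact detDies7_sound x hrows hge 15 6 le_rfl h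
    · rw [if_neg h6, Bool.and_eq_true] at h
      obtain ⟨hvis, hall⟩ := h
      obtain ⟨e, he, heq⟩ := child_of_slotOK7 hA x hrows hge hj1 (by omega) hvis
      have hchild := List.all_eq_true.1 hall e he
      rw [heq, show (List.range j).map (colPack7 x) ++ [colPack7 x j] = (List.range (j + 1)).map (colPack7 x) by
        rw [List.range_succ, List.map_append, List.map_singleton]] at hchild
      exact ih (j + 1) (by omega) (by omega) hchild

/-- **Soundness of `search7`.** If CHECK A holds for all slots and `search7 c = true`, no LP-tight point of slack `4` has torus-`0`
column `repVal7 c`. -/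
theorem search7_sound (hA : ∀ c' < 120, ∀ h < 336, slotOK7 c' h = true) {c : ℕ} (hs : search7 c = true)
    (x : ℕ → ℕ) (_hbox : ∀ j, x j ≤ 4) (hrows : ∀ r < 1274, capRowVal7 x r ≤ rhs7s 4 r)
    (hge : (208 : ℤ) ≤ ∑ j ∈ range 401, (x j : ℤ)) (hcol : ∀ z < 42, colN7 x 0 z = repVal7 c z) : False := by
  unfold search7 at hs
  have e : ((List.range 42).map fun z => repVal7 c z * 2 ^ (10 * z)).sum = colPack7 x 0 := by
    unfold colPack7 pack10; rw [list_sum_range_map]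
    exact sum_congr rfl fun z hz => by rw [hcol z (mem_range.1 hz)]
  rw [e, show [colPack7 x 0] = (List.range 1).map (colPack7 x) by simp] at hs
  exact srch7_sound hA x hrows hge 6 1 le_rfl (by norm_num) hs

end Summit.MatrixMultiplication.OmegaCensus.SmallFormats
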